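import Summits.PneNP.PneNP.Theorems.ChebyshevTracialDesignRungPiecesOneSided
import Summits.PneNP.PneNP.Theorems.ChebyshevTracialDesignRungAssembly
import Summits.PneNP.PneNP.Theorems.ChebyshevTracialDesignProfileExtrapolationHalf
import Summits.PneNP.PneNP.Theorems.ChebyshevTracialDesignLevelWeightCompl
import HarnessLib

/-!
# Cell pnp-psdrank, route `ChebyshevTracialDesign`: assembling the NON-TIGHT-FREE `r = 1` rung — the three terms of the spread approximation for an
# ARBITRARY rectangle, and the reduced-instance spread-cell bound in complement-symmetric form

Harmonic backbone of the crux `TracialDecayExp20` (stmt-PneNP-19878), brick 50a (prover g10; NTF mod KL, MEMO-12 §3 «next prover (0)»).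
* §1 **`value_le_three_terms`** — for `n` even, an exact design `(n, t = 2c'+1, T, D, B, C, w)` (`4 ≤ D ≤ 2c'`, `n ≤ 4t`, `T + 2q + 2 ≤ t`, `q ≤ D`,
  `D + 2q + 3 ≤ t`, `2q² + q ≤ n/2`), ANY family `A` of `t`-cuts and ANY set `Y` of perfect matchings, a Kupavskii–Zakharov spread approximation of the
  edge sets of `Y` (parameter `τ > 0`, cores `≤ q`, `40q ≤ n`) and the reduced-instance spread-cell bound `hVNS` (value `≤ B·Ψ` on dense
  `t''`-cuts × dense homogeneous families for reduced designs; threshold `exp(−c₀ dq m) ≤ β`):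
  `Σ_{U∈A} Σ_{M∈Y} W(U,M) ≤ B·[(τ^{q+1})⁻¹ + τ^{q+1}·n^q·4^q·√P_{D−4} + 2·4^q·τ^{q+1}·(Ψ + β)]` — the one-sided twin of brick 32's
  `abs_value_le_three_terms`, with the SNT contradiction replaced by brick 49's dichotomy;
* §2 `levelFactor_pow_le_exp` — the unconditional attenuation factor of brick 47 is `≤ exp 2000` in every reduced instance (`T² ≤ 100m`, …);
  `prod_atten_reduced_le` — the reduced tails `P^{(m)}_{D'}`, `m ≥ n − 2q`, `D' ≥ D − q`, are `≤ P* = Π_{i ≤ (D−q)/2}(2i+1)/(n−2q−2i)`;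
* (§3 of the plan — the spread-cell bound for reduced cut sizes on EITHER side of `m/2`, complements `[m] ∖ U`, in exactly the shape of `hVNS`
  with `Ψ = exp 2000 · √P*` — is the next file, brick 50b `ChebyshevTracialDesignReducedSpreadCell.reduced_spreadCell_value_le_of_globalLevelD`;
  this file is unconditional.)
[cite: Rothvoss2017, §2 and Lemma 7 (PDF pp. 6–8)] [cite: KupavskiiZakharov2022, Lemma 11] [cite: KeevashLifshitz2023, Thm. 1.8]
Stature: support/instrument, unconditional (the `hVNS` binder of `value_le_three_terms` is discharged mod KL in brick 50b). WHAT THIS IS NOT: not yet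
the final `exp(−a·dq n)` statement (constants: brick 50c), not the crux, nothing on psd rank, no P-vs-NP content. Supports stmt-PneNP-19878.
-/

set_option linter.dupNamespace false -- `Summit.PneNP.PneNP.…`: summit = sub-problem (D-0017)

noncomputable section

namespace Summit.PneNP.PneNP.Theorems.ChebyshevTracialDesignRungAssemblyAll

open Finset Literature.Combinatorics.Optimization
open Literature.Barriers.PneNP hiding verts
open Literature.Combinatorics.SetFamily
open Literature.Combinatorics.SimpleGraph.CycleSpace
open Literature.Combinatorics.AssociationSchemes.CutMatchingRestriction
open Literature.Combinatorics.AssociationSchemes.HomogeneousMatchingFamilies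
open Literature.Combinatorics.Additive.KeevashLifshitz
open Summit.PneNP.PneNP.Theorems.ChebyshevTracialDesignProfilePolynomial (card_pmatch_pos)
open Summit.PneNP.PneNP.Theorems.ChebyshevTracialDesignDipoleHitRatio (card_pmatch_eq_pmCount)
open Summit.PneNP.PneNP.Theorems.ChebyshevTracialDesignLevelTail (prod_atten_le_of_le atten_factor_le_one)
open Summit.PneNP.PneNP.Theorems.ChebyshevTracialDesignRungCells
open Summit.PneNP.PneNP.Theorems.ChebyshevTracialDesignRungPieces
open Summit.PneNP.PneNP.Theorems.ChebyshevTracialDesignRungAssembly (sum_eq_remainder_add_pieces card_filter_mem_eq)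
open Summit.PneNP.PneNP.Theorems.ChebyshevTracialDesignRungPiecesOneSided
open Summit.PneNP.PneNP.Theorems.ChebyshevTracialDesignProfileExtrapolationHalf
open Summit.PneNP.PneNP.Theorems.ChebyshevTracialDesignLevelWeightCompl

variable {n : ℕ}

/-! ### §1 The three terms, one-sidedly, for an arbitrary rectangle -/

/-- **The three-term bound for an ARBITRARY rectangle.** [cite: KupavskiiZakharov2022, Lemma 11] [cite: Rothvoss2017, §2 (PDF p. 6)] -/
theorem value_le_three_terms {c' T Dg q n₁ : ℕ} {Bv τ c₀ β Ψ : ℝ} {C : Finset ℕ} {w : ℕ → ℝ} (hn : Even n) (hn1 : 1 ≤ n)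
    (hdes : IsExactDesign n (2 * c' + 1) T Dg Bv C w) (hDg : Dg ≤ 2 * c') (hDg4 : 4 ≤ Dg)
    (hbal : n ≤ 4 * (2 * c' + 1)) (hq : 40 * q ≤ n) (hn₁ : n₁ + 2 * q ≤ n)
    (hTq : T + 2 * q + 2 ≤ 2 * c' + 1) (hqD : q ≤ Dg) (hDq3 : Dg + 2 * q + 3 ≤ 2 * c' + 1) (hqN : 2 * q * q + q ≤ n / 2) (hτ : 0 < τ)
    (hVNS : ∀ (m t'' D' : ℕ) (w' : ℕ → ℝ), n₁ ≤ m → Even m → Odd t'' → m ≤ 5 * t'' → m ≤ 5 * (m - t'') →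
      T ≤ t'' → T ≤ m - t'' → D' + 3 ≤ t'' → D' + 3 ≤ m - t'' → Dg ≤ D' + q → D' ≤ Dg →
      (∀ c ∈ C, (Qset m t'' c).Nonempty) →
      (∀ p : Polynomial ℝ, p.natDegree ≤ D' → ∑ c ∈ C, w' c * p.eval (c : ℝ) = -p.eval 0) →
      ∑ c ∈ C, |w' c| ≤ Bv →
      ∀ (X : Finset (OddSet m)), (∀ U ∈ X, U.1.card = t'') →
      ∀ (Y' : Finset (PMatch m)), IsRelHomogeneous τ (perfectMatchings (univ : Finset (Fin m))) (Y'.image Subtype.val) →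
      Real.exp (-(c₀ * dq m)) ≤ (X.card : ℝ) / (m.choose t'' : ℝ) →
      Real.exp (-(c₀ * dq m)) ≤ (Y'.card : ℝ) / (Fintype.card (PMatch m) : ℝ) →
      ∑ U ∈ X, ∑ M ∈ Y', levelWeight m t'' C w' U M ≤ Bv * Ψ)
    (hΨ : 0 ≤ Ψ) (hβ : ∀ m : ℕ, n ≤ m + 2 * q → m ≤ n → Real.exp (-(c₀ * dq m)) ≤ β) (hβ0 : 0 ≤ β)
    (A : Finset (OddSet n)) (hA : ∀ U ∈ A, U.1.card = 2 * c' + 1) (Y : Finset (PMatch n))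
    (Dk : SpreadApproximation (perfectMatchings (univ : Finset (Fin n))) (Y.image Subtype.val) τ q) :
    ∑ U ∈ A, ∑ M ∈ Y, levelWeight n (2 * c' + 1) C w U M ≤
      Bv * ((τ ^ (q + 1))⁻¹ + τ ^ (q + 1) * (n : ℝ) ^ q *
        ((4 : ℝ) ^ q * Real.sqrt (∏ j ∈ range ((Dg - 4) / 2 + 1), ((2 * j + 1 : ℝ) / ((n : ℝ) - 2 * j)))) +
        2 * (4 : ℝ) ^ q * τ ^ (q + 1) * (Ψ + β)) := by
  classical
  have hBv : 0 ≤ Bv := (sum_nonneg fun c _ => abs_nonneg (w c)).trans hdes.2.2.2.2.2.2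
  have hPM : (0 : ℝ) < Fintype.card (PMatch n) := by exact_mod_cast card_pmatch_pos hn
  have h𝒜 : ((perfectMatchings (univ : Finset (Fin n))).card : ℝ) = Fintype.card (PMatch n) := by
    rw [card_pmatch_eq_pmCount, pmCount]
  have h𝒜ne : (perfectMatchings (univ : Finset (Fin n))).Nonempty := by
    rw [← card_pos]; exact_mod_cast (h𝒜 ▸ hPM : (0 : ℝ) < ((perfectMatchings (univ : Finset (Fin n))).card : ℝ))
  set P : ℝ := ∏ j ∈ range ((Dg - 4) / 2 + 1), ((2 * j + 1 : ℝ) / ((n : ℝ) - 2 * j)) with hPdef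
  -- split along the spread approximation
  have hsplit : ∑ U ∈ A, ∑ M ∈ Y, levelWeight n (2 * c' + 1) C w U M =
      ∑ U ∈ A, ∑ M ∈ Y.filter (fun M => M.1 ∈ Dk.remainder), levelWeight n (2 * c' + 1) C w U M +
        ∑ i : Fin Dk.k, ∑ U ∈ A, ∑ M ∈ Y.filter (fun M => M.1 ∈ Dk.piece i), levelWeight n (2 * c' + 1) C w U M := by
    rw [sum_comm (s := univ), ← sum_add_distrib]
    exact sum_congr rfl fun U _ => sum_eq_remainder_add_pieces Y Dk _
  rw [hsplit]
  -- the remainder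
  have hrem : ∑ U ∈ A, ∑ M ∈ Y.filter (fun M => M.1 ∈ Dk.remainder), levelWeight n (2 * c' + 1) C w U M ≤ Bv * (τ ^ (q + 1))⁻¹ := by
    refine (le_abs_self _).trans ((abs_sum_sum_levelWeight_le_col _ C w A _).trans ?_)
    refine mul_le_mul hdes.2.2.2.2.2.2 ?_ (by positivity) hBv
    rw [card_filter_mem_eq Y Dk.remainder_subset, ← h𝒜]
    exact Dk.card_remainder_div_le hτ h𝒜ne
  -- the pieces
  have hpieces : ∀ i : Fin Dk.k, ∑ U ∈ A, ∑ M ∈ Y.filter (fun M => M.1 ∈ Dk.piece i), levelWeight n (2 * c' + 1) C w U M ≤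
      (4 : ℝ) ^ q * (Bv * Real.sqrt P) +
        2 * (4 : ℝ) ^ q * (((supersets (perfectMatchings (univ : Finset (Fin n))) (Dk.core i)).card : ℝ) / Fintype.card (PMatch n)) *
          (Bv * (Ψ + β)) :=
    fun i => piece_value_le hn hdes hDg hDg4 hbal hq hn₁ hTq hqD hDq3 hqN hVNS hΨ hβ hβ0 A hA Y Dk i
  have hsumpieces : ∑ i : Fin Dk.k, ∑ U ∈ A, ∑ M ∈ Y.filter (fun M => M.1 ∈ Dk.piece i), levelWeight n (2 * c' + 1) C w U M ≤
      τ ^ (q + 1) * (n : ℝ) ^ q * ((4 : ℝ) ^ q * (Bv * Real.sqrt P)) + 2 * (4 : ℝ) ^ q * τ ^ (q + 1) * (Bv * (Ψ + β)) := by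
    refine (sum_le_sum fun i _ => hpieces i).trans ?_
    rw [sum_add_distrib, sum_const, card_univ, Fintype.card_fin, nsmul_eq_mul]
    have hk := card_pieces_le hn hn1 Y hτ Dk
    have hstars : ∑ i : Fin Dk.k, (((supersets (perfectMatchings (univ : Finset (Fin n))) (Dk.core i)).card : ℝ) / Fintype.card (PMatch n)) ≤
        τ ^ (q + 1) := by
      rw [← h𝒜]
      refine (Dk.sum_card_supersets_div_le hτ.le h𝒜ne).trans ?_
      have hY1 : ((Y.image Subtype.val).card : ℝ) / (perfectMatchings (univ : Finset (Fin n))).card ≤ 1 := by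
        rw [div_le_one (by rw [h𝒜]; exact hPM), h𝒜, card_image_of_injective _ Subtype.val_injective]
        exact_mod_cast (card_le_univ Y).trans_eq Finset.card_univ
      calc τ ^ (q + 1) * (((Y.image Subtype.val).card : ℝ) / (perfectMatchings (univ : Finset (Fin n))).card)
          ≤ τ ^ (q + 1) * 1 := mul_le_mul_of_nonneg_left hY1 (by positivity)
        _ = τ ^ (q + 1) := mul_one _
    have h1 : (Dk.k : ℝ) * ((4 : ℝ) ^ q * (Bv * Real.sqrt P)) ≤ τ ^ (q + 1) * (n : ℝ) ^ q * ((4 : ℝ) ^ q * (Bv * Real.sqrt P)) :=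
      mul_le_mul_of_nonneg_right hk (by positivity)
    have hΨβ : 0 ≤ Ψ + β := add_nonneg hΨ hβ0
    have h2 : ∑ i : Fin Dk.k, 2 * (4 : ℝ) ^ q *
        (((supersets (perfectMatchings (univ : Finset (Fin n))) (Dk.core i)).card : ℝ) / Fintype.card (PMatch n)) * (Bv * (Ψ + β)) ≤
        2 * (4 : ℝ) ^ q * τ ^ (q + 1) * (Bv * (Ψ + β)) := by
      have : ∑ i : Fin Dk.k, 2 * (4 : ℝ) ^ q *
          (((supersets (perfectMatchings (univ : Finset (Fin n))) (Dk.core i)).card : ℝ) / Fintype.card (PMatch n)) * (Bv * (Ψ + β)) =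
          2 * (4 : ℝ) ^ q * (Bv * (Ψ + β)) *
            ∑ i : Fin Dk.k, (((supersets (perfectMatchings (univ : Finset (Fin n))) (Dk.core i)).card : ℝ) / Fintype.card (PMatch n)) := by
        rw [mul_sum]; exact sum_congr rfl fun i _ => by ring
      rw [this]
      calc 2 * (4 : ℝ) ^ q * (Bv * (Ψ + β)) *
            ∑ i : Fin Dk.k, (((supersets (perfectMatchings (univ : Finset (Fin n))) (Dk.core i)).card : ℝ) / Fintype.card (PMatch n))
          ≤ 2 * (4 : ℝ) ^ q * (Bv * (Ψ + β)) * τ ^ (q + 1) := mul_le_mul_of_nonneg_left hstars (by positivity)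
        _ = _ := by ring
    linarith
  calc _ ≤ Bv * (τ ^ (q + 1))⁻¹ +
        (τ ^ (q + 1) * (n : ℝ) ^ q * ((4 : ℝ) ^ q * (Bv * Real.sqrt P)) + 2 * (4 : ℝ) ^ q * τ ^ (q + 1) * (Bv * (Ψ + β))) :=
        add_le_add hrem hsumpieces
    _ = _ := by ring

/-! ### §2 Uniform bounds for the reduced instances: the attenuation factor and the tails -/

/-- **The unconditional attenuation factor is `≤ exp 2000` in the reduced instances**: for `2m₁+1 ≤ T`, `2T ≤ c₂ + 2`,
`m ≤ 40·(m/2 − c₂ − m₁)` and `T² ≤ 100m`: `(1 + 2m₁(2m₁+1)/(4(c₂−m₁+1)(m/2−c₂−m₁)))^{c₂} ≤ exp 2000` (`(1+x)^k ≤ exp(kx)`). [folklore] -/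
theorem levelFactor_pow_le_exp {m c₂ m₁ T : ℕ} (hm₁ : 2 * m₁ + 1 ≤ T) (hTc : 2 * T ≤ c₂ + 2) (hK : m ≤ 40 * (m / 2 - c₂ - m₁))
    (hT2 : T * T ≤ 100 * m) (hm : 1 ≤ m) :
    (1 + (2 * m₁ * (2 * m₁ + 1) : ℝ) / (4 * (c₂ - m₁ + 1) * ((m / 2 - c₂ - m₁ : ℕ) : ℝ))) ^ c₂ ≤ Real.exp 2000 := by
  set K : ℝ := ((m / 2 - c₂ - m₁ : ℕ) : ℝ) with hKdef
  have hKpos : 0 < K := by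
    rw [hKdef]; exact_mod_cast (show 0 < m / 2 - c₂ - m₁ by omega)
  have hcm : (0 : ℝ) < (c₂ : ℝ) - m₁ + 1 := by
    have : (m₁ : ℝ) ≤ c₂ := by exact_mod_cast (show m₁ ≤ c₂ by omega)
    linarith
  set ρ : ℝ := (2 * m₁ * (2 * m₁ + 1) : ℝ) / (4 * (c₂ - m₁ + 1) * K) with hρ
  have hρ0 : 0 ≤ ρ := by rw [hρ]; positivity
  -- `c₂ ρ ≤ 2000`
  have hcρ : (c₂ : ℝ) * ρ ≤ 2000 := by
    rw [hρ, ← mul_div_assoc, div_le_iff₀ (by positivity)]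
    have h1 : (c₂ : ℝ) ≤ 2 * ((c₂ : ℝ) - m₁ + 1) := by
      have : (2 * (2 * m₁ + 1) : ℝ) ≤ (c₂ : ℝ) + 2 := by exact_mod_cast (show 2 * (2 * m₁ + 1) ≤ c₂ + 2 by omega)
      linarith
    have h2 : (2 * m₁ * (2 * m₁ + 1) : ℝ) ≤ (T : ℝ) * T := by
      have : (2 * m₁ * (2 * m₁ + 1) : ℕ) ≤ T * T := Nat.mul_le_mul (by omega) hm₁
      exact_mod_cast this
    have h3 : (T : ℝ) * T ≤ 100 * m := by exact_mod_cast hT2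
    have h4 : (m : ℝ) ≤ 40 * K := by rw [hKdef]; exact_mod_cast hK
    have hc0 : (0 : ℝ) ≤ c₂ := Nat.cast_nonneg _
    calc (c₂ : ℝ) * (2 * m₁ * (2 * m₁ + 1)) ≤ (2 * ((c₂ : ℝ) - m₁ + 1)) * (100 * m) :=
          mul_le_mul h1 (h2.trans h3) (by positivity) (by linarith)
      _ ≤ (2 * ((c₂ : ℝ) - m₁ + 1)) * (100 * (40 * K)) := by nlinarith
      _ = 2000 * (4 * ((c₂ : ℝ) - m₁ + 1) * K) := by ring
  calc (1 + ρ) ^ c₂ ≤ (Real.exp ρ) ^ c₂ := pow_le_pow_left₀ (by linarith) (by linarith [Real.add_one_le_exp ρ]) c₂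
    _ = Real.exp (c₂ * ρ) := (Real.exp_nat_mul ρ c₂).symm
    _ ≤ Real.exp 2000 := Real.exp_le_exp.2 hcρ

/-- **The reduced tails are below `P*`**: for `n ≤ m + 2q`, `K* ≤ K`, `4K ≤ m + 3` and `2q + 4K* ≤ n + 3`:
`Π_{i<K}(2i+1)/(m−2i) ≤ Π_{i<K*}(2i+1)/(n−2q−2i)`. [cite: GodsilMeagher2015, §15.2] -/
theorem prod_atten_reduced_le {m q K Ks : ℕ} (hmq : n ≤ m + 2 * q) (hKs : Ks ≤ K) (hK : 4 * K ≤ m + 3) (hq : 2 * q + 4 * Ks ≤ n + 3) :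
    ∏ i ∈ range K, ((2 * i + 1 : ℝ) / ((m : ℝ) - 2 * i)) ≤ ∏ i ∈ range Ks, ((2 * i + 1 : ℝ) / ((n : ℝ) - 2 * q - 2 * i)) := by
  refine (prod_atten_le_of_le (n := m) hKs hK).trans (prod_le_prod (fun i hi => (atten_factor_le_one (n := m)
    (by have := mem_range.1 hi; omega)).1) fun i hi => ?_)
  have hi' := mem_range.1 hi
  have hd : (0 : ℝ) < (n : ℝ) - 2 * q - 2 * i := by
    have : (2 * q + 2 * i : ℝ) < n := by exact_mod_cast (show 2 * q + 2 * i < n by omega)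
    linarith
  have hmn : (n : ℝ) - 2 * q ≤ m := by
    have : (n : ℝ) ≤ m + 2 * q := by exact_mod_cast hmq
    linarith
  exact div_le_div_of_nonneg_left (by positivity) hd (by linarith)

end Summit.PneNP.PneNP.Theorems.ChebyshevTracialDesignRungAssemblyAll
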